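import Summits.AtomisticToContinuum.Crystallization.Theorems.FreeSplittingCertificatesStrictSplittingRuleFarPencilFlux4Integral

/-!
# `StrictSplittingRule` (stmt-AtomisticToContinuum-12560): the interface density of the generic far flux for a RADIAL weight — the three NEAR channels

Route `FreeSplittingCertificates`, crux r3 `StrictSplittingRule` (H12⋆ = `stub_coreJointCoercive`), unit b2b-freesplit-B gen 18.
VALUE = a kernel identity behind the bookkeeping of HOME CERT.md §23 (2) / FAR-LEMMA-SPEC §14 (b): the weighted far theorems
(`farPencil4_weighted_integral_le_of_integrable/_of_growth/_of_affineTail/_of_locallyAffine`) hand the near half of the split the interface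
term `∫ 2χ⟪∇χ, Φ⟫`, `Φ = aΦ₁ + bΦ₂ + cΦ₃ + nΨ₁`.  For the RADIAL weights the architecture uses, `χ(x) = g(|x|²)`, this term is
`∫ 4 g(s) g′(s) · [a·s⁻³|v|² + (b+c)·s⁻⁴⟪x,v⟫² + n·s⁻³(vᵀ(∇v)x − (div v)⟪x,v⟫)]`, `s = |x|²` — i.e. exactly the three flux channels
`F_a, F_b, F_n` of the certificate-form near ledger (`nearcert.py`/`boxnear.py` terms `flux1/flux2/flux3`, coefficient `4χ·dχ/ds`) with the
channel vector `(a, b+c, n)`; the radial flux `Φ₃` and the `⟪x,v⟫v`-flux `Φ₂` feed the SAME channel, which is why a four-parameter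
certificate has a three-component near flux vector (`(7/45, 7/24, 3/40)` for certificate D, `(259/720, 19/48, 247/1800)` for B).
NOT a proof of H12⋆, NOT summit progress.

* `fpFlux4_dot_self`: `⟪x, Φ(x)⟫ = a·s⁻³|v|² + (b+c)·s⁻⁴⟪x,v⟫² + n·s⁻³(vᵀGx − tr G·⟪x,v⟫)` (pure algebra; `s⁻⁴·s = s⁻³` also at `x = 0`);
* `fderiv_fpSq_apply`, `fpGradS_radial`: `∂ⱼ(g ∘ |·|²)(x) = 2xⱼ·g′(|x|²)`;
* `fpFlux4DotGrad_radial`, **`two_chi_fpFlux4DotGrad_radial`**: the displayed identity.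
HONEST FRAMING: calculus/algebra about explicit densities; the flux identification between the lattice ledger and the continuum interpolant
(FAR-LEMMA-SPEC §14 (e) item (3)) is a separate item; NOT a proof of H12⋆, NOT summit progress.
-/

noncomputable section

open Topology Filter

namespace Summit.AtomisticToContinuum.Crystallization.Theorems.StrictSplittingRuleBirth

/-! ## `⟪x, Φ(x)⟫`: the radial component of the generic flux -/

/-- `|x|⁻²⁽ᵏ⁺²⁾·|x|² = |x|⁻²⁽ᵏ⁺¹⁾` for every `x` (at `x = 0` both sides vanish since `0⁻¹ = 0`). -/
theorem fpSq_inv_pow_succ_mul (x : Fin 3 → ℝ) (k : ℕ) : (fpSq x)⁻¹ ^ (k + 2) * fpSq x = (fpSq x)⁻¹ ^ (k + 1) := by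
  by_cases h : fpSq x = 0
  · simp [h]
  · rw [pow_succ, mul_assoc, inv_mul_cancel₀ h, mul_one]

/-- **The radial component of the generic flux**: `Σⱼ xⱼΦⱼ(x) = a·s⁻³|v|² + (b+c)·s⁻⁴⟪x,v⟫² + n·s⁻³(vᵀ(∇v)x − (div v)⟪x,v⟫)`,
`s = |x|²` — the radial flux `Φ₃ = |x|⁻¹⁰⟪x,v⟫²x` and `Φ₂ = |x|⁻⁸⟪x,v⟫v` land in the same channel. -/
theorem fpFlux4_dot_self (a b c n : ℝ) (v : (Fin 3 → ℝ) → (Fin 3 → ℝ)) (x : Fin 3 → ℝ) :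
    x 0 * fpFlux4 a b c n v x 0 + x 1 * fpFlux4 a b c n v x 1 + x 2 * fpFlux4 a b c n v x 2 =
      a * ((fpSq x)⁻¹ ^ 3 * fpSq (v x)) + (b + c) * ((fpSq x)⁻¹ ^ 4 * fpDot x (v x) ^ 2) +
        n * ((fpSq x)⁻¹ ^ 3 * (fpVGX x (v x) (fpGrad v x) - fpTr (fpGrad v x) * fpDot x (v x))) := by
  have k3 : (x 0 ^ 2 + x 1 ^ 2 + x 2 ^ 2)⁻¹ ^ 4 * (x 0 ^ 2 + x 1 ^ 2 + x 2 ^ 2) = (x 0 ^ 2 + x 1 ^ 2 + x 2 ^ 2)⁻¹ ^ 3 :=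
    fpSq_inv_pow_succ_mul x 2
  have k4 : (x 0 ^ 2 + x 1 ^ 2 + x 2 ^ 2)⁻¹ ^ 5 * (x 0 ^ 2 + x 1 ^ 2 + x 2 ^ 2) = (x 0 ^ 2 + x 1 ^ 2 + x 2 ^ 2)⁻¹ ^ 4 :=
    fpSq_inv_pow_succ_mul x 3
  unfold fpFlux4 fpDot fpVGX fpTr fpSq
  linear_combination (a * (v x 0 ^ 2 + v x 1 ^ 2 + v x 2 ^ 2)) * k3 +
    (c * (x 0 * v x 0 + x 1 * v x 1 + x 2 * v x 2) ^ 2) * k4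

/-! ## Radial weights `χ = g ∘ |·|²` -/

/-- `|·|²` is differentiable. -/
theorem differentiableAt_fpSq (x : Fin 3 → ℝ) : DifferentiableAt ℝ fpSq x := by
  have h : DifferentiableAt ℝ (fun y : Fin 3 → ℝ => y 0 ^ 2 + y 1 ^ 2 + y 2 ^ 2) x := by fun_prop
  exact h

/-- `∂ⱼ|x|² = 2xⱼ`. -/
theorem fderiv_fpSq_apply (x : Fin 3 → ℝ) (j : Fin 3) : fderiv ℝ fpSq x (fpE j) = 2 * x j := by
  have h1 : HasLineDerivAt ℝ fpSq (2 * fpDot x (fpE j)) x (fpE j) := hasDerivAt_fpSq_line x (fpE j)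
  rw [← (differentiableAt_fpSq x).lineDeriv_eq_fderiv, h1.lineDeriv]
  fin_cases j <;> simp [fpDot, fpE]

/-- **Gradient of a radial weight**: `∂ⱼ(g ∘ |·|²)(x) = 2xⱼ·g′(|x|²)` whenever `g` is differentiable at `|x|²`. -/
theorem fpGradS_radial {g : ℝ → ℝ} {x : Fin 3 → ℝ} (hg : DifferentiableAt ℝ g (fpSq x)) (j : Fin 3) :
    fpGradS (fun y => g (fpSq y)) x j = 2 * x j * deriv g (fpSq x) := by
  unfold fpGradS
  rw [show (fun y => g (fpSq y)) = g ∘ fpSq from rfl, fderiv_comp x hg (differentiableAt_fpSq x),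
    ContinuousLinearMap.comp_apply, fderiv_fpSq_apply, ← toSpanSingleton_deriv, ContinuousLinearMap.toSpanSingleton_apply,
    smul_eq_mul]

/-- The interface density of the generic flux for a radial weight: `⟪∇χ, Φ⟫ = 2g′(|x|²)·⟪x, Φ(x)⟫`. -/
theorem fpFlux4DotGrad_radial {g : ℝ → ℝ} {x : Fin 3 → ℝ} (hg : DifferentiableAt ℝ g (fpSq x)) (a b c n : ℝ)
    (v : (Fin 3 → ℝ) → (Fin 3 → ℝ)) :
    fpFlux4DotGrad a b c n v (fun y => g (fpSq y)) x =
      2 * deriv g (fpSq x) *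
        (x 0 * fpFlux4 a b c n v x 0 + x 1 * fpFlux4 a b c n v x 1 + x 2 * fpFlux4 a b c n v x 2) := by
  unfold fpFlux4DotGrad
  rw [fpGradS_radial hg 0, fpGradS_radial hg 1, fpGradS_radial hg 2]
  ring

/-- **THE THREE NEAR CHANNELS.**  For a radial weight `χ(x) = g(|x|²)` (differentiable at `|x|²`) the integrand of the interface term of the
weighted far theorems is
`2χ⟪∇χ, Φ⟫ = 4 g(s) g′(s) · [a·s⁻³|v|² + (b+c)·s⁻⁴⟪x,v⟫² + n·s⁻³(vᵀ(∇v)x − (div v)⟪x,v⟫)]`, `s = |x|²`,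
i.e. the channels `F_a = s⁻³|v|²`, `F_b = s⁻⁴⟪x,v⟫²`, `F_n = s⁻³(vᵀ(∇v)x − (div v)⟪x,v⟫)` of the certificate-form near ledger weighted by
`4χ·dχ/ds` with channel vector `(a, b+c, n)` (HOME CERT.md §23 (2): `(7/45, 7/24, 3/40)` for certificate D).  NOT a proof of H12⋆,
NOT summit progress. -/
theorem two_chi_fpFlux4DotGrad_radial {g : ℝ → ℝ} {x : Fin 3 → ℝ} (hg : DifferentiableAt ℝ g (fpSq x)) (a b c n : ℝ)
    (v : (Fin 3 → ℝ) → (Fin 3 → ℝ)) :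
    2 * g (fpSq x) * fpFlux4DotGrad a b c n v (fun y => g (fpSq y)) x =
      4 * g (fpSq x) * deriv g (fpSq x) *
        (a * ((fpSq x)⁻¹ ^ 3 * fpSq (v x)) + (b + c) * ((fpSq x)⁻¹ ^ 4 * fpDot x (v x) ^ 2) +
          n * ((fpSq x)⁻¹ ^ 3 * (fpVGX x (v x) (fpGrad v x) - fpTr (fpGrad v x) * fpDot x (v x)))) := by
  rw [fpFlux4DotGrad_radial hg, fpFlux4_dot_self]
  ring

/-- The channel vector of certificate D: `(a, b+c, n) = (7/45, 7/24, 3/40)` (`23/30 − 19/40 = 7/24`). -/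
example : ((7 : ℝ) / 45, (23 : ℝ) / 30 + (-(19 / 40)), (3 : ℝ) / 40) = (7 / 45, 7 / 24, 3 / 40) := by norm_num

/-- The channel vector of certificate B: `(a, b+c, n) = (259/720, 19/48, 247/1800)` (`1111/720 − 413/360 = 19/48`). -/
example : ((259 : ℝ) / 720, (1111 : ℝ) / 720 + (-(413 / 360)), (247 : ℝ) / 1800) = (259 / 720, 19 / 48, 247 / 1800) := by
  norm_num

end Summit.AtomisticToContinuum.Crystallization.Theorems.StrictSplittingRuleBirth
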